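import Summits.Ventures.PackingBounds.Configurations.CL17Count

/-!
# Cohn–Li in dimension `18`, II: the extra words of `𝔽₂^{4×4}` and the code `C₈` (kernel facts)

Framing: lottery ticket; floor = certified bounds/negative ranges. Venture `PackingBounds` (cell
`pub-packcert`, seat `pub-packcert-energy`).

Cohn–Li's `18`-dimensional configuration (arXiv:2411.04916, §4) uses, besides the pairs/squares `w8` and crosses `x6`
of `CL17Codes.lean`: the `32` weight-`6` matrices `y6` obtained by cyclically rotating rows and columns of
`[0000;1100;1010;1001]` (`i < 16`, class `A` of the paper) and of `[1110;0010;0100;1000]` (`16 ≤ i < 32`, class `B`),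
and the `8`-dimensional code `C₈ ⊂ C₁₀` of matrices whose rows, columns, main diagonal and shifted main diagonal have
equal sums, twisted by the character `χ(c) = ⟨c, v⟩`, `v = [1100;1100;0000;0000]` (mask `51`). This file enters
`y6`, the generators `c8gen` of `C₈` (`c8 m`, `m < 256`, their span), the combined word table
`wd = w8 ++ x6 ++ y6` (`78` supports of the odd-pattern vectors) with the axis tables `eT`, `gT` (the `√2`- and
`√6`-axis values of the corresponding vectors, scale `6`), and lets the kernel check: every pair of distinct
supports satisfies `36 |S ∩ S'| + |2 e e' + 6 g g'| ≤ 144` (the whole case analysis of odd-pattern pairs in one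
table), `C₈ ⊥` all `78` words (on generators, by additivity), and for `0 ≠ c ∈ C₈`: `wt c ≥ 6`, or `wt c ≥ 4` and
`χ(c) = 1` (weight-`4` words of `C₈` are `χ`-odd, so the corresponding deep holes get opposite axis signs).

## References
* H. Cohn, A. Li, *Improved kissing numbers in seventeen through twenty-one dimensions*, arXiv:2411.04916 (2024), §4. [`CohnLi2024`]
-/

namespace Summit.Ventures.PackingBounds.Config.CL17

open Finset Leech Golay

/-! ### Data -/

/-- The `32` weight-`6` supports of the `2048` extra vectors: cyclic row/column rotations of `[0000;1100;1010;1001]`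
(`i < 16`) and of `[1110;0010;0100;1000]` (`16 ≤ i < 32`), as `16`-bit masks. [cite: CohnLi2024, §4] -/
def y6 (i : ℕ) : ℕ :=
  match i with
  | 0 => 934 | 1 => 1628 | 2 => 2387 | 3 => 3241 | 4 => 12437 | 5 => 14944 | 6 => 21257 | 7 => 23558
  | 8 => 24634 | 9 => 26048 | 10 => 37066 | 11 => 38192 | 12 => 42499 | 13 => 43276 | 14 => 49253 | 15 => 51856
  | 16 => 4679 | 17 => 4792 | 18 => 7496 | 19 => 9329 | 20 => 9358 | 21 => 11137 | 22 => 18194 | 23 => 18461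
  | 24 => 18658 | 25 => 28964 | 26 => 33067 | 27 => 33236 | 28 => 36388 | 29 => 47122 | 30 => 54401 | 31 => 57928
  | _ => 0

/-- Generators of `C₈` (rows, columns, main and shifted main diagonal with equal sums). [cite: CohnLi2024, §4] -/
def c8gen (i : ℕ) : ℕ :=
  match i with
  | 0 => 255 | 1 => 854 | 2 => 1285 | 3 => 2396 | 4 => 4427 | 5 => 8494 | 6 => 16667 | 7 => 33137
  | _ => 0

/-- The combined support table: pairs/squares (`i < 30`), crosses (`30 ≤ i < 46`), the extra words (`46 ≤ i < 78`). -/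
def wd (i : ℕ) : ℕ := if i < 30 then w8 i else if i < 46 then x6 (i - 30) else y6 (i - 46)

/-- `√2`-axis amplitude of the odd-pattern vector on `wd i` (scale `6`): `0` (pairs/squares), `6` (crosses), `3`. -/
def eT (i : ℕ) : ℤ := if i < 30 then 0 else if i < 46 then 6 else 3

/-- `√6`-axis amplitude: `0` (pairs/squares, crosses), `+3` (class `A`), `−3` (class `B`). -/
def gT (i : ℕ) : ℤ := if i < 46 then 0 else if i < 62 then 3 else -3

/-- Axis contribution to the norm: `2 e² + 6 g²`. -/
def kO (i : ℕ) : ℤ := 2 * eT i * eT i + 6 * gT i * gT i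

/-- `XOR` of the generators of `C₈` selected by the bits of `m`, using the first `j` generators. -/
def c8Aux : ℕ → ℕ → ℕ
  | 0, _ => 0
  | j + 1, m => (if m.testBit j then c8gen j else 0) ^^^ c8Aux j m

/-- The element of `C₈` with coordinates `m < 256`. -/
def c8 (m : ℕ) : ℕ := c8Aux 8 m

/-- The character `χ(c) = ⟨c, v⟩ mod 2`, `v = [1100;1100;0000;0000]` (mask `51`). [cite: CohnLi2024, §4] -/
def chi (c : ℕ) : Bool := decide ((supp c ∩ supp 51).card % 2 = 1)

/-- `c8Aux` is additive. -/
theorem c8Aux_xor (j m m' : ℕ) : c8Aux j (m ^^^ m') = c8Aux j m ^^^ c8Aux j m' := by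
  induction j with
  | zero => simp [c8Aux]
  | succ j ih =>
    simp only [c8Aux, Nat.testBit_xor, ih]
    cases m.testBit j <;> cases m'.testBit j <;> simp [Nat.xor_assoc, Nat.xor_left_comm]

/-- `c8` is additive. -/
theorem c8_xor (m m' : ℕ) : c8 (m ^^^ m') = c8 m ^^^ c8 m' := c8Aux_xor 8 m m'

/-! ### Parity is additive -/

/-- Parity of the number of cells of `S` carrying a `1` is additive under `XOR`. -/
theorem card_inter_supp_xor_mod_two (S : Finset (Fin 24)) (x y : ℕ) :
    (S ∩ supp (x ^^^ y)).card % 2 = ((S ∩ supp x).card + (S ∩ supp y).card) % 2 := by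
  rw [← card_filter_testBit, ← card_filter_testBit, ← card_filter_testBit]
  have h := card_filter_xor_add_finset S (fun j => x.testBit j.val) (fun j => y.testBit j.val)
  have e : (S.filter fun j : Fin 24 => (x ^^^ y).testBit j.val = true) =
      S.filter fun j => (x.testBit j.val ^^ y.testBit j.val) = true := by
    congr 1; ext j; rw [Nat.testBit_xor]
  rw [e]; omega

/-- `χ` is additive. -/
theorem chi_xor (x y : ℕ) : chi (x ^^^ y) = (chi x ^^ chi y) := by
  unfold chi
  rw [Finset.inter_comm, card_inter_supp_xor_mod_two, Finset.inter_comm (supp 51) (supp x),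
    Finset.inter_comm (supp 51) (supp y)]
  rcases Nat.mod_two_eq_zero_or_one (supp x ∩ supp 51).card with h1 | h1 <;>
    rcases Nat.mod_two_eq_zero_or_one (supp y ∩ supp 51).card with h2 | h2 <;>
    simp [Nat.add_mod, h1, h2]

/-! ### Kernel facts -/

/-- The extra words have weight `6` and live on the cells. [cite: CohnLi2024, §4] -/
theorem y6_facts : ∀ i < 32, popK 24 24 (y6 i) = 6 ∧ y6 i < 65536 := by
  decide +kernel

set_option maxRecDepth 100000 in
/-- Per-word facts of the combined table: support on the cells, weight `8` or `6`, and the four numerical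
inequalities used for a pair of vectors on the SAME support and for a vector against the axis vectors and the
deep holes, the norm `36 |S| + (2e² + 6g²) = 288`, and the signs of the axis tables. -/
theorem wd_facts : ∀ i < 78, wd i < 65536 ∧ popK 24 24 (wd i) = (if i < 30 then 8 else 6) ∧
    36 * ((popK 24 24 (wd i) : ℤ) - 4) + kO i ≤ 144 ∧ (30 ≤ i → 36 * (popK 24 24 (wd i) : ℤ) - kO i ≤ 144) ∧
    24 * (popK 24 24 (wd i) : ℤ) - 48 + 8 * eT i ≤ 144 ∧ 24 * eT i ≤ 144 ∧ 12 * eT i + 36 * |gT i| ≤ 144 ∧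
    36 * (popK 24 24 (wd i) : ℤ) + kO i = 288 ∧ 0 ≤ eT i ∧ 0 ≤ kO i := by
  decide +kernel

set_option maxRecDepth 100000 in
set_option maxHeartbeats 2000000 in
/-- **The pair table**: two distinct supports meet in few enough cells for their axis terms —
`36 |S ∩ S'| + |2 e e' + 6 g g'| ≤ 144` for all `i ≠ i'` (`78 · 78` bit counts). [cite: CohnLi2024, §4] -/
theorem wd_inter : ∀ i < 78, ∀ i' < 78,
    i = i' ∨ 36 * (popK 24 24 (wd i &&& wd i') : ℤ) + |2 * eT i * eT i' + 6 * gT i * gT i'| ≤ 144 := by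
  decide +kernel

set_option maxRecDepth 100000 in
/-- **`C₈ ⊥` every support** (on the generators; by additivity for the whole code). [cite: CohnLi2024, §4] -/
theorem c8gen_orth : ∀ j < 8, ∀ i < 78, popK 24 24 (wd i &&& c8gen j) % 2 = 0 := by
  decide +kernel

set_option maxRecDepth 100000 in
/-- **Weights of `C₈` with the twist**: a nonzero word of `C₈` has weight `≥ 6`, or weight `≥ 4` and `χ = 1`.
[cite: CohnLi2024, §4] -/
theorem c8_dist : ∀ m < 256, m = 0 ∨ 6 ≤ popK 16 24 (c8 m) ∨
    (4 ≤ popK 16 24 (c8 m) ∧ popK 24 24 (c8 m &&& 51) % 2 = 1) := by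
  decide +kernel

/-! ### Consequences in `Finset` language -/

/-- Supports of the combined table consist of cells. -/
theorem supp_wd_sub {i : ℕ} (hi : i < 78) : supp (wd i) ⊆ cells :=
  fun _ hj => mem_cells.mpr (val_lt_of_mem_supp (wd_facts i hi).1 hj)

/-- Sizes of the supports: `8` for `i < 30`, `6` otherwise. -/
theorem card_supp_wd {i : ℕ} (hi : i < 78) : (supp (wd i)).card = if i < 30 then 8 else 6 := by
  have h := (wd_facts i hi).2.1
  rw [← wt_eq_popK] at h; exact h

/-- The extra words, as entries of the combined table. -/
theorem wd_y6 {i : ℕ} (hi : i < 32) : wd (46 + i) = y6 i := by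
  simp only [wd, show ¬ (46 + i < 30) by omega, show ¬ (46 + i < 46) by omega, if_false]
  congr 1; omega

/-- The crosses, as entries of the combined table. -/
theorem wd_x6 {i : ℕ} (hi : i < 16) : wd (30 + i) = x6 i := by
  simp only [wd, show ¬ (30 + i < 30) by omega, show 30 + i < 46 by omega, if_false, if_true]
  congr 1; omega

/-- The pairs/squares, as entries of the combined table. -/
theorem wd_w8 {i : ℕ} (hi : i < 30) : wd i = w8 i := by
  simp [wd, hi]

/-- `|supp (y6 i)| = 6`. -/
theorem card_supp_y6 (i : Fin 32) : (supp (y6 i)).card = 6 := by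
  have h := (y6_facts i i.isLt).1
  rw [← wt_eq_popK] at h; exact h

/-- **Pair table, `Finset` form.** -/
theorem wd_inter_le {i i' : ℕ} (hi : i < 78) (hi' : i' < 78) (hne : i ≠ i') :
    36 * ((supp (wd i) ∩ supp (wd i')).card : ℤ) + |2 * eT i * eT i' + 6 * gT i * gT i'| ≤ 144 := by
  rw [card_supp_inter]
  rcases wd_inter i hi i' hi' with h | h
  · exact absurd h hne
  · exact h

/-- The combined table has pairwise distinct supports. -/
theorem wd_inj {i i' : ℕ} (hi : i < 78) (hi' : i' < 78) (h : supp (wd i) = supp (wd i')) : i = i' := by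
  by_contra hne
  have h1 := wd_inter_le hi hi' hne
  rw [← h, Finset.inter_self, card_supp_wd hi] at h1
  have h2 := abs_nonneg (2 * eT i * eT i' + 6 * gT i * gT i')
  split_ifs at h1 <;> push_cast at h1 <;> linarith

/-- Parity through the span of `C₈`. -/
theorem even_inter_supp_c8Aux {S : Finset (Fin 24)} (hgen : ∀ j < 8, Even (S ∩ supp (c8gen j)).card) :
    ∀ j ≤ 8, ∀ m, Even (S ∩ supp (c8Aux j m)).card
  | 0, _, m => by simp [c8Aux, supp]
  | j + 1, hj, m => by
    simp only [c8Aux]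
    apply even_inter_supp_xor
    · split_ifs
      · exact hgen j (by omega)
      · simp [supp]
    · exact even_inter_supp_c8Aux hgen j (by omega) m

/-- **A word of `C₈` meets every support evenly.** -/
theorem even_card_wd_inter_c8 {i : ℕ} (hi : i < 78) (m : ℕ) : Even (supp (wd i) ∩ supp (c8 m)).card :=
  even_inter_supp_c8Aux (fun j hj => by rw [card_supp_inter, Nat.even_iff]; exact c8gen_orth j hj i hi) 8 le_rfl m

/-- `m ⊕ m' < 256` for `m, m' < 256`. -/
theorem xor_lt_256 {m m' : ℕ} (hm : m < 256) (hm' : m' < 256) : m ^^^ m' < 256 := by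
  have := Nat.xor_lt_two_pow (n := 8) (by simpa using hm) (by simpa using hm'); simpa using this

/-- `χ` from the kernel's bit count. -/
theorem chi_eq_true_of_popK {c : ℕ} (h : popK 24 24 (c &&& 51) % 2 = 1) : chi c = true := by
  rw [chi, decide_eq_true_eq, card_supp_inter]; exact h

/-- **Distances in `C₈` with the twist**, restricted-weight form: for `m ≠ m'`, the difference `c8 m ⊕ c8 m'` has
`≥ 6` ones on the cells, or `≥ 4` ones and `χ (c8 m) ≠ χ (c8 m')`. -/
theorem wtK_c8_xor {m m' : ℕ} (hm : m < 256) (hm' : m' < 256) (hne : m ≠ m') :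
    6 ≤ wtK 16 (c8 m ^^^ c8 m') ∨ (4 ≤ wtK 16 (c8 m ^^^ c8 m') ∧ chi (c8 m) ≠ chi (c8 m')) := by
  rw [← c8_xor, wtK_eq_popK]
  rcases c8_dist (m ^^^ m') (xor_lt_256 hm hm') with h0 | h6 | ⟨h4, hx⟩
  · exact absurd (eq_of_xor_eq_zero h0) hne
  · exact Or.inl h6
  · refine Or.inr ⟨h4, fun h => ?_⟩
    have hc := chi_eq_true_of_popK hx
    rw [c8_xor, chi_xor, h] at hc
    simp at hc

/-! ### Patterns on the extra words -/

/-- Increasing enumeration of the cells of the extra word `i`. -/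
def ypos (i : Fin 32) : Fin 6 ≃o supp (y6 i) := (supp (y6 i)).orderIsoOfFin (card_supp_y6 i)

/-- The odd `6`-sign pattern `v` placed on the cells of the extra word `i`. -/
def paty (i : Fin 32) (v : ℕ) : Fin 24 → Bool :=
  fun j => if h : j ∈ supp (y6 i) then xbit v ((ypos i).symm ⟨j, h⟩) else false

/-- Values of `paty` along the enumeration. -/
theorem paty_apply_ypos (i : Fin 32) (v : ℕ) (r : Fin 6) : paty i v (ypos i r) = xbit v r := by
  simp only [paty, dif_pos (ypos i r).2, Subtype.coe_eta, OrderIso.symm_apply_apply]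

/-- `paty i v` has an odd number of minus signs on its support. -/
theorem odd_card_paty (i : Fin 32) (v : ℕ) : Odd ((supp (y6 i)).filter fun j => paty i v j = true).card := by
  rw [← card_filter_orderIso (ypos i) (fun j => paty i v j = true)]
  simp only [paty_apply_ypos]
  exact odd_card_xbit v

/-- `paty i` is injective on `v < 32`. -/
theorem paty_inj {i : Fin 32} {v v' : ℕ} (hv : v < 32) (hv' : v' < 32)
    (h : ∀ j ∈ supp (y6 i), paty i v j = paty i v' j) : v = v' := by
  by_contra hne
  obtain ⟨r, hr⟩ := xbit_ne_of_ne hv hv' hne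
  exact hr (by rw [← paty_apply_ypos, ← paty_apply_ypos]; exact h _ (ypos i r).2)

end Summit.Ventures.PackingBounds.Config.CL17
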